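import Literature.NumberTheory.Automorphic.ArchMultiWallCasimirTools        -- ★ p851189 (this seat): the ℓ^∞ device, Option-Fubini, slot jets under a proper datum, properness of the outer conjugation
import Literature.NumberTheory.Automorphic.ArchMultiWallCasimirTransport    -- ★ (this seat): the invariant's shape, index transport, empty base, isometries, frame at `a = (2,−2)`
import Literature.Analysis.Calculus.IteratedFDerivProductWords              -- ★ p851187∕p851199 «dict» (LH10-p02 (g6)): `contDiffOn_iteratedFDeriv_slice_apply`, `norm_iteratedFDeriv_slice_apply_le`, `exists_forall_norm_iteratedFDeriv_le_of_iteratedDeriv_partial`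
import HarnessLib

/-!
# The multi-wall Casimir STEP `ι → Option ι`: from uniform joint jets of the `ι`-place normalised elliptic orbital objects to those of the `(Option ι)`-place object (diagonal frame)
# (Varadarajan 1989 §6.4 Thms 22–24; Bouaziz 1994 §3.1 (I₂); Hörmander Thm. 1.1.9; Rogawski 1990 §8.2)

Topic `NumberTheory/Automorphic`.  THEOREMS ONLY (no `def`, no instance, no notation, no axiom, no named fact, no `sorry`); kernel lane `--kind proof --supports stmt-HodgeConjecture-24833`.
Cell `pub/hodgecm-mathlib`, crux H413 (`stmt-HodgeConjecture-24833`), line LH3 (closer stub `stub_N9`, direct road), letter L3′ organ O-L3′ (ii), (α4) «all-orders transport», stage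
**(α4-S6) «MULTI-WALL base points»** (LH3-plan (g3) 2026-09-02T10:09Z; frozen invariant v4 `F0/P3c/LH10/LH10-p01/g4/s6/MultiWallInvFrozen.v4.LH10p01g4.lean`, adopted byte-for-byte by the
(S7) consumer LH3-p01 (g5) 10:55Z).  Seat LH10-p01 (g4).  Count-neutral.
Brick (S6-B5b) part 2b.  Namespaces `Literature.Analysis.Calculus` (§1, frame-free) and `Literature.NumberTheory.Automorphic.RankOneCasimir` (§2).

* §1 **`sliceJet_family`** (frame-free): for `Ψ : M × Z → E` `C^∞` on `univ ×ˢ U`, zero when the `M`-variable leaves a closed `K₀`, with joint jets bounded on `K₀ ×ˢ A`: the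
  slice-jet family `g_{ζ,I}(X) = D^l_Z Ψ(X,·)(ζ)(b∘I)` is `C^∞` in `X`, bounded in every `X`-jet uniformly in `(ζ, I)` (★ «dict» (D2″) nested jets ≤ joint jets), zero off `K₀`.
* §2 **`multiWall_step_diag`**: `InvDiag ι (wl ∘ some) → InvDiag (Option ι) wl`.  The new place `none` is the OUTER one-place integral (★ Option-Fubini); its integrand family,
  indexed by `J_l = (cube_ι × KV) × words`, is ONE `C^∞`-bounded family by the hypothesis at the slot `M₂(ℂ) × V` (re-bracketing ISOMETRY, §1); the ★ ℓ^∞ device bounds the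
  `t`-jets of the outer functional of every member on `0 < |t| < 1`; ★ slot lemma (+ ★ properness) IDENTIFIES them with the mixed partials `∂_t^k D_ζ^l` of the
  `(Option ι)`-object in split variables (★ splitting ISOMETRY); ★ «dict» (D4) turns mixed partials into the joint jet.
HONEST LABEL: HC_CM is proved only modulo the 7 printed citations (2 remaining: hLiu418 = `stmt-HodgeConjecture-24832`, h413 = `stmt-HodgeConjecture-24833`) until rung 0 closes;
bookkeeping over ★ engines, count-neutral, pays nothing by itself.

## References
* [Varadarajan1989] V. S. Varadarajan, *An Introduction to Harmonic Analysis on Semisimple Lie Groups* (1989), §6.4 Thms 22–24.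
* [Bouaziz1994IntegralesOrbitales] A. Bouaziz, *Intégrales orbitales sur les groupes de Lie réductifs*, Ann. Sci. ÉNS 27 (1994), §3.1 (I₁)–(I₂) p. 579.
* [HormanderALPDO1] L. Hörmander, *The Analysis of Linear Partial Differential Operators I*, 2nd ed. (1990), §1.1 Thm. 1.1.9, §2.1.
* [Rogawski1990] J. D. Rogawski, *Automorphic Representations of Unitary Groups in Three Variables*, Ann. of Math. Stud. 123 (1990), §8.2 pp. 119–123.
-/

set_option autoImplicit false

noncomputable section

/-! ## §1 Frame-free: sup-norm isometries re-bracketing the variables (private plumbing), and the slice-jet family of a jointly smooth function -/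

namespace Literature.Analysis.Calculus

open _root_.Set _root_.Filter _root_.Topology
open scoped ContDiff

section Isometries

variable {ι : Type} [Fintype ι] {V : Type} [NormedAddCommGroup V] [NormedSpace ℝ V] {M : Type} [NormedAddCommGroup M] [NormedSpace ℝ M]

/-- `‖ψ‖ = max |ψ none| ‖ψ ∘ some‖` for `ψ : Option ι → ℝ` (sup norm). [folklore] -/
private theorem norm_option_eq_max (ψ : Option ι → ℝ) : ‖ψ‖ = max ‖ψ none‖ ‖fun i => ψ (some i)‖ := by
  refine le_antisymm ?_ (max_le (norm_le_pi_norm ψ none) ?_)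
  · refine (pi_norm_le_iff_of_nonneg (le_max_of_le_left (norm_nonneg _))).2 fun o => ?_
    cases o with
    | none => exact le_max_left _ _
    | some i => exact (norm_le_pi_norm (fun i => ψ (some i)) i).trans (le_max_right _ _)
  · exact (pi_norm_le_iff_of_nonneg (norm_nonneg _)).2 fun i => norm_le_pi_norm ψ (some i)

/-- **The splitting isometry `((Option ι → ℝ) × V) ≃ₗᵢ (ℝ × ((ι → ℝ) × V))`, `(ψ, v) ↦ (ψ none, (ψ ∘ some, v))`**, with inverse `(t, (ψ′, v)) ↦ (o ↦ o.elim t ψ′, v)` (sup norms).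
[folklore] -/
private theorem exists_splitOption_isometry :
    ∃ e : ((Option ι → ℝ) × V) ≃ₗᵢ[ℝ] (ℝ × ((ι → ℝ) × V)),
      (∀ x : (Option ι → ℝ) × V, e x = (x.1 none, (fun i => x.1 (some i), x.2))) ∧
      ∀ y : ℝ × ((ι → ℝ) × V), e.symm y = (fun o => Option.elim o y.1 y.2.1, y.2.2) := by
  refine ⟨{ toFun := fun x => (x.1 none, (fun i => x.1 (some i), x.2))
            invFun := fun y => (fun o => Option.elim o y.1 y.2.1, y.2.2)
            map_add' := fun x y => rfl
            map_smul' := fun c x => rfl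
            left_inv := fun x => by
              ext o
              · cases o <;> rfl
              · rfl
            right_inv := fun y => rfl
            norm_map' := fun x => by
              show ‖(x.1 none, (fun i => x.1 (some i), x.2))‖ = ‖x‖
              rw [Prod.norm_def, Prod.norm_def, Prod.norm_def, norm_option_eq_max, max_assoc] }, fun x => rfl, fun y => rfl⟩

/-- **The re-bracketing isometry `((ι → ℝ) × (M × V)) ≃ₗᵢ (M × ((ι → ℝ) × V))`, `(ψ′, (Y, v)) ↦ (Y, (ψ′, v))`** (sup norms). [folklore] -/
private theorem exists_rebracket_isometry :
    ∃ e : ((ι → ℝ) × (M × V)) ≃ₗᵢ[ℝ] (M × ((ι → ℝ) × V)),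
      (∀ x : (ι → ℝ) × (M × V), e x = (x.2.1, (x.1, x.2.2))) ∧ ∀ y : M × ((ι → ℝ) × V), e.symm y = (y.2.1, (y.1, y.2.2)) := by
  refine ⟨{ toFun := fun x => (x.2.1, (x.1, x.2.2))
            invFun := fun y => (y.2.1, (y.1, y.2.2))
            map_add' := fun x y => rfl
            map_smul' := fun c x => rfl
            left_inv := fun x => rfl
            right_inv := fun y => rfl
            norm_map' := fun x => by
              show ‖(x.2.1, (x.1, x.2.2))‖ = ‖x‖
              simp only [Prod.norm_def]
              exact max_left_comm _ _ _ }, fun x => rfl, fun y => rfl⟩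

end Isometries

section SliceFamily

variable {M : Type*} [NormedAddCommGroup M] [NormedSpace ℝ M]
variable {Z : Type*} [NormedAddCommGroup Z] [NormedSpace ℝ Z]
variable {E : Type*} [NormedAddCommGroup E] [NormedSpace ℝ E]

/-- **THE SLICE-JET FAMILY.**  `Ψ : M × Z → E` `C^∞` on `univ ×ˢ U` (`U ⊆ Z` open), vanishing when the `M`-variable leaves a CLOSED `K₀`, with JOINT jets of every order bounded on `K₀ ×ˢ A`
(`A ⊆ U`).  For directions from a finite list `b : κ → Z` and `l`, the family `g_{ζ,I} : M → E`, `g_{ζ,I}(X) = D^l_Z Ψ(X, ·)(ζ)(b ∘ I)` (`ζ ∈ A`, `I : Fin l → κ`) is: (i) `C^∞` in `X` (for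
`ζ ∈ U`); (ii) bounded in every `X`-jet UNIFORMLY in `(ζ, I)` (nested jets ≤ joint jets, ★ «dict» (D2″)); (iii) zero off `K₀`.  These are the three hypotheses of the `ℓ^∞` device ★
`exists_forall_norm_iteratedDeriv_orbitalIntegral_le_of_uniform_family`. [cite: HormanderALPDO1, §1.1 pp. 7–12, §2.1] -/
theorem sliceJet_family (Ψ : M × Z → E) {U : Set Z} (hU : IsOpen U) (hΨ : ContDiffOn ℝ ∞ Ψ ((Set.univ : Set M) ×ˢ U))
    {K₀ : Set M} (hK₀ : IsClosed K₀) (h0 : ∀ (X : M) (ζ : Z), X ∉ K₀ → Ψ (X, ζ) = 0)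
    {A : Set Z} (hAU : A ⊆ U) (hbd : ∀ N : ℕ, ∃ B : ℝ, ∀ X ∈ K₀, ∀ ζ ∈ A, ‖iteratedFDeriv ℝ N Ψ (X, ζ)‖ ≤ B)
    {κ : Type*} [Fintype κ] (b : κ → Z) (l : ℕ) :
    (∀ (ζ : Z) (I : Fin l → κ), ζ ∈ U → ContDiff ℝ ∞ fun X : M => iteratedFDeriv ℝ l (fun q : Z => Ψ (X, q)) ζ fun i => b (I i)) ∧
    (∀ m : ℕ, ∃ B : ℝ, ∀ (ζ : Z) (I : Fin l → κ), ζ ∈ A → ∀ X : M,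
      ‖iteratedFDeriv ℝ m (fun X : M => iteratedFDeriv ℝ l (fun q : Z => Ψ (X, q)) ζ fun i => b (I i)) X‖ ≤ B) ∧
    (∀ (ζ : Z) (I : Fin l → κ) (X : M), X ∉ K₀ → iteratedFDeriv ℝ l (fun q : Z => Ψ (X, q)) ζ (fun i => b (I i)) = 0) := by
  have hW : IsOpen ((Set.univ : Set M) ×ˢ U) := isOpen_univ.prod hU
  -- (iii) off `K₀` the slice is identically zero
  have hzero : ∀ (ζ : Z) (I : Fin l → κ) (X : M), X ∉ K₀ → iteratedFDeriv ℝ l (fun q : Z => Ψ (X, q)) ζ (fun i => b (I i)) = 0 := by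
    intro ζ I X hX
    rw [iteratedFDeriv_eq_zero_of_forall_eq_zero (fun q => h0 X q hX) l ζ]
    rfl
  refine ⟨fun ζ I hζ => ?_, fun m => ?_, hzero⟩
  · -- (i) ★ (D2″) with `{X | (X, ζ) ∈ univ ×ˢ U} = univ`
    have h := contDiffOn_iteratedFDeriv_slice_apply hW hΨ (l := l) ζ (fun i => b (I i))
    have hset : {p₁ : M | (p₁, ζ) ∈ (Set.univ : Set M) ×ˢ U} = Set.univ := Set.eq_univ_of_forall fun X => ⟨Set.mem_univ _, hζ⟩
    rw [hset] at h
    exact contDiffOn_univ.1 h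
  · -- (ii) nested jets ≤ joint jets on `K₀`, zero jets off `K₀` (open complement)
    obtain ⟨B, hB⟩ := hbd (m + l)
    set C : ℝ := ∑ k, ‖b k‖ with hC
    have hC0 : 0 ≤ C := Finset.sum_nonneg fun k _ => norm_nonneg _
    have hprod : ∀ I : Fin l → κ, ∏ j, ‖b (I j)‖ ≤ C ^ l := fun I => by
      calc ∏ j, ‖b (I j)‖ ≤ ∏ _j : Fin l, C := Finset.prod_le_prod (fun j _ => norm_nonneg _) fun j _ =>
              Finset.single_le_sum (f := fun k => ‖b k‖) (fun k _ => norm_nonneg _) (Finset.mem_univ (I j))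
        _ = C ^ l := by rw [Finset.prod_const, Finset.card_univ, Fintype.card_fin]
    refine ⟨max B 0 * C ^ l, fun ζ I hζ X => ?_⟩
    by_cases hX : X ∈ K₀
    · calc ‖iteratedFDeriv ℝ m (fun X : M => iteratedFDeriv ℝ l (fun q : Z => Ψ (X, q)) ζ fun i => b (I i)) X‖
            ≤ ‖iteratedFDeriv ℝ (m + l) Ψ (X, ζ)‖ * ∏ j, ‖b (I j)‖ :=
              norm_iteratedFDeriv_slice_apply_le hW hΨ (x := (X, ζ)) ⟨Set.mem_univ _, hAU hζ⟩ m l (fun i => b (I i))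
        _ ≤ max B 0 * C ^ l := mul_le_mul ((hB X hX ζ hζ).trans (le_max_left _ _)) (hprod I) (Finset.prod_nonneg fun j _ => norm_nonneg _) (le_max_right _ _)
    · have hvan : iteratedFDeriv ℝ m (fun X : M => iteratedFDeriv ℝ l (fun q : Z => Ψ (X, q)) ζ fun i => b (I i)) X = 0 :=
        iteratedFDeriv_eq_zero_of_forall_mem_eq_zero hK₀.isOpen_compl (fun X' hX' => hzero ζ I X' hX') m hX
      rw [hvan, norm_zero]
      exact mul_nonneg (le_max_right _ _) (pow_nonneg hC0 l)

end SliceFamily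

end Literature.Analysis.Calculus

/-! ## §2 THE STEP `ι → Option ι` -/

namespace Literature.NumberTheory.Automorphic.RankOneCasimir

open _root_.Complex _root_.Matrix _root_.MeasureTheory _root_.Set _root_.Filter _root_.Topology _root_.NumberField _root_.NumberField.InfinitePlace
open _root_.Literature.NumberTheory.Automorphic _root_.Literature.NumberTheory.Automorphic.UnitaryGroup _root_.Literature.Analysis.Calculus
open scoped Matrix.Norms.Operator MatrixGroups ComplexConjugate ContDiff Real

section Step

variable (L : Type) [Field L] [NumberField L]

/-- A coordinate of the open signed unit cube is off the wall: `0 < ±x < 1 ⇒ sin x ≠ 0` (`1 < π`). [folklore] -/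
private theorem sin_ne_zero_of_signedUnit {b : Bool} {x : ℝ} (h : 0 < (if b then x else -x) ∧ (if b then x else -x) < 1) : Real.sin x ≠ 0 := by
  have hπ : (1 : ℝ) < Real.pi := by linarith [Real.pi_gt_three]
  have hx : 0 < |x| ∧ |x| < 1 := by
    cases b
    · simp only [Bool.false_eq_true, ↓reduceIte] at h
      exact ⟨abs_pos.2 (by linarith), abs_lt.2 ⟨by linarith, by linarith⟩⟩
    · simp only [↓reduceIte] at h
      exact ⟨abs_pos.2 (by linarith), abs_lt.2 ⟨by linarith, by linarith⟩⟩
  rw [Ne, Real.sin_eq_zero_iff_of_lt_of_lt (by linarith [neg_abs_le x]) (by linarith [le_abs_self x])]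
  exact abs_pos.1 hx.1

/-- `0 < ±x < 1 ⇒ 0 < |x| < 1`. [folklore] -/
private theorem abs_pos_lt_one_of_signedUnit {b : Bool} {x : ℝ} (h : 0 < (if b then x else -x) ∧ (if b then x else -x) < 1) : 0 < |x| ∧ |x| < 1 := by
  cases b
  · simp only [Bool.false_eq_true, ↓reduceIte] at h
    exact ⟨abs_pos.2 (by linarith), abs_lt.2 ⟨by linarith, by linarith⟩⟩
  · simp only [↓reduceIte] at h
    exact ⟨abs_pos.2 (by linarith), abs_lt.2 ⟨by linarith, by linarith⟩⟩

variable {ι : Type} [Fintype ι] (wl : Option ι → {w : InfinitePlace L // IsComplex w}) (z : Option ι → Circle)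
    [∀ o, MeasurableSpace (unitaryGroupOfForm (starRingEnd ℂ) ((Matrix.diagonal ![(2 : L), -2]).map (wl o).1.embedding))]
    [∀ o, BorelSpace (unitaryGroupOfForm (starRingEnd ℂ) ((Matrix.diagonal ![(2 : L), -2]).map (wl o).1.embedding))]
    (ν : ∀ o, Measure (unitaryGroupOfForm (starRingEnd ℂ) ((Matrix.diagonal ![(2 : L), -2]).map (wl o).1.embedding))) [∀ o, (ν o).IsHaarMeasure] [∀ o, (ν o).IsMulRightInvariant]

/-- **THE MULTI-WALL STEP `ι → Option ι` (diagonal frame).**  If the `ι`-place normalised elliptic orbital objects at the places `wl ∘ some` satisfy the invariant — JOINT `(ψ′, v)`-jets of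
every order bounded on the open signed unit cube times any compact of ANY finite-dimensional smooth slot, for every jointly smooth compactly `Y`-supported family with values in ANY Banach
space — then so does the `(Option ι)`-place object.  PROOF: the new place `none` is the OUTER one-place integral (Option-Fubini ★ `multiOrbitalIntegral_option_eq_integral_integral`); its
integrand family `Y ↦ D^l_ζ 𝓕_ι[Φ′](ζ, (Y, ·))(b∘I)` indexed by `(ζ, I) ∈ (cube_ι × KV) × words` is ONE `C^∞`-bounded family by the HYPOTHESIS at the slot `M₂(ℂ) × V` (§1
`sliceJet_family`, ★ «dict» (D2″)); the `ℓ^∞` device ★ `exists_forall_norm_iteratedDeriv_orbitalIntegral_le_of_uniform_family` bounds `∂_t^k` of the outer functional of every member on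
`0 < |t| < 1`; ★ `iteratedFDeriv_integral_slot_of_proper` (+ ★ `isCompact_preimage_conj_torusPoint`) identifies these with the mixed partials `∂_t^k D_ζ^l` of the `(Option ι)`-object
(variables split by the sup-norm isometry `(ψ, v) ↦ (ψ none, (ψ ∘ some, v))`); ★ «dict» (D4) turns mixed partials into the joint jet. [cite: Varadarajan1989, §6.4 Thms 22–24]
[cite: Bouaziz1994IntegralesOrbitales, §3.1 (I₂) p. 579] [cite: HormanderALPDO1, §1.1 Thm. 1.1.9] [cite: Rogawski1990, §8.2 pp. 122–123] -/
theorem multiWall_step_diag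
    (hInv : ∀ (V : Type) [NormedAddCommGroup V] [NormedSpace ℝ V] [FiniteDimensional ℝ V] (E : Type) [NormedAddCommGroup E] [NormedSpace ℝ E] [CompleteSpace E]
      (Φ : V × (ι → Matrix (Fin 2) (Fin 2) ℂ) → E) (_hΦ : ContDiff ℝ ∞ Φ) (KV : Set V) (_hKV : IsCompact KV)
      (K : Set (ι → Matrix (Fin 2) (Fin 2) ℂ)) (_hK : IsCompact K) (_h0 : ∀ (v : V) (Y : ι → Matrix (Fin 2) (Fin 2) ℂ), Y ∉ K → Φ (v, Y) = 0)
      (F : (ι → ℝ) × V → E) (_hF : ∀ x : (ι → ℝ) × V, F x = (∏ i, 2 * Real.sin (x.1 i)) •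
        ∫ h : (∀ i : ι, unitaryGroupOfForm (starRingEnd ℂ) ((Matrix.diagonal ![(2 : L), -2]).map (wl (some i)).1.embedding)), Φ (x.2, fun i => (((h i * ⟨circleDiagonal 2 ![z (some i) * Circle.exp (x.1 i), z (some i) * Circle.exp (-(x.1 i))], circleDiagonal_mem_archLocal_diagonal L 2 ![(2 : L), -2] (wl (some i)) _⟩ * (h i)⁻¹ : unitaryGroupOfForm (starRingEnd ℂ) ((Matrix.diagonal ![(2 : L), -2]).map (wl (some i)).1.embedding)) : GL (Fin 2) ℂ) : Matrix (Fin 2) (Fin 2) ℂ)) ∂(Measure.pi fun i => ν (some i)))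
      (n : ℕ) (ε : ι → Bool),
      ∃ B : ℝ, ∀ ψ : ι → ℝ, (∀ i, 0 < (if ε i then ψ i else -ψ i) ∧ (if ε i then ψ i else -ψ i) < 1) → ∀ v ∈ KV, ‖iteratedFDeriv ℝ n F (ψ, v)‖ ≤ B) :
    ∀ (V : Type) [NormedAddCommGroup V] [NormedSpace ℝ V] [FiniteDimensional ℝ V] (E : Type) [NormedAddCommGroup E] [NormedSpace ℝ E] [CompleteSpace E]
      (Φ : V × (Option ι → Matrix (Fin 2) (Fin 2) ℂ) → E) (_hΦ : ContDiff ℝ ∞ Φ) (KV : Set V) (_hKV : IsCompact KV)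
      (K : Set (Option ι → Matrix (Fin 2) (Fin 2) ℂ)) (_hK : IsCompact K) (_h0 : ∀ (v : V) (Y : Option ι → Matrix (Fin 2) (Fin 2) ℂ), Y ∉ K → Φ (v, Y) = 0)
      (F : (Option ι → ℝ) × V → E) (_hF : ∀ x : (Option ι → ℝ) × V, F x = (∏ o, 2 * Real.sin (x.1 o)) •
        ∫ h : (∀ o : Option ι, unitaryGroupOfForm (starRingEnd ℂ) ((Matrix.diagonal ![(2 : L), -2]).map (wl o).1.embedding)), Φ (x.2, fun o => (((h o * ⟨circleDiagonal 2 ![z o * Circle.exp (x.1 o), z o * Circle.exp (-(x.1 o))], circleDiagonal_mem_archLocal_diagonal L 2 ![(2 : L), -2] (wl o) _⟩ * (h o)⁻¹ : unitaryGroupOfForm (starRingEnd ℂ) ((Matrix.diagonal ![(2 : L), -2]).map (wl o).1.embedding)) : GL (Fin 2) ℂ) : Matrix (Fin 2) (Fin 2) ℂ)) ∂(Measure.pi ν))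
      (n : ℕ) (ε : Option ι → Bool),
      ∃ B : ℝ, ∀ ψ : Option ι → ℝ, (∀ o, 0 < (if ε o then ψ o else -ψ o) ∧ (if ε o then ψ o else -ψ o) < 1) → ∀ v ∈ KV, ‖iteratedFDeriv ℝ n F (ψ, v)‖ ≤ B := by
  intro V _ _ _ E _ _ _ Φ hΦ KV hKV K hK h0 FO hFO n ε
  haveI : ∀ o, SecondCountableTopology (unitaryGroupOfForm (starRingEnd ℂ) ((Matrix.diagonal ![(2 : L), -2]).map (wl o).1.embedding)) := fun o =>
    secondCountableTopology_archLocal L 2 (Matrix.diagonal ![(2 : L), -2]) (wl o)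
  haveI : ∀ o, LocallyCompactSpace (unitaryGroupOfForm (starRingEnd ℂ) ((Matrix.diagonal ![(2 : L), -2]).map (wl o).1.embedding)) := fun o =>
    locallyCompactSpace_archLocal L 2 (Matrix.diagonal ![(2 : L), -2]) (wl o)
  obtain ⟨ha, hreal, hsgn, hpq, hqe⟩ := diagTwoNegTwo_frame L (wl none)
  -- the projections of the support and the inner family `Φ′` at the slot `M₂ × V`
  have hK₀ : IsCompact ((fun W : Option ι → Matrix (Fin 2) (Fin 2) ℂ => W none) '' K) := hK.image (continuous_apply none)
  have hK₀c : IsClosed ((fun W : Option ι → Matrix (Fin 2) (Fin 2) ℂ => W none) '' K) := hK₀.isClosed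
  have hK' : IsCompact ((fun W : Option ι → Matrix (Fin 2) (Fin 2) ℂ => fun i => W (some i)) '' K) :=
    hK.image (continuous_pi fun i => continuous_apply (some i))
  obtain ⟨Φ', hΦ'⟩ : ∃ Φ' : (Matrix (Fin 2) (Fin 2) ℂ × V) × (ι → Matrix (Fin 2) (Fin 2) ℂ) → E,
      ∀ p, Φ' p = Φ (p.1.2, fun o => Option.elim o p.1.1 p.2) := ⟨_, fun _ => rfl⟩
  have hΦ'eq : Φ' = fun p => Φ (p.1.2, fun o => Option.elim o p.1.1 p.2) := funext hΦ'
  have helim : ContDiff ℝ ∞ fun p : (Matrix (Fin 2) (Fin 2) ℂ × V) × (ι → Matrix (Fin 2) (Fin 2) ℂ) => (fun o => Option.elim o p.1.1 p.2 : Option ι → Matrix (Fin 2) (Fin 2) ℂ) := by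
    refine contDiff_pi.2 fun o => ?_
    cases o with
    | none => exact contDiff_fst.comp contDiff_fst
    | some i => exact (contDiff_apply ℝ (Matrix (Fin 2) (Fin 2) ℂ) i).comp contDiff_snd
  have hΦ'd : ContDiff ℝ ∞ Φ' := by
    rw [hΦ'eq]
    exact hΦ.comp ((contDiff_snd.comp contDiff_fst).prodMk helim)
  have h0' : ∀ (v' : Matrix (Fin 2) (Fin 2) ℂ × V) (Y' : ι → Matrix (Fin 2) (Fin 2) ℂ),
      Y' ∉ (fun W : Option ι → Matrix (Fin 2) (Fin 2) ℂ => fun i => W (some i)) '' K → Φ' (v', Y') = 0 := by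
    intro v' Y' hY'
    rw [hΦ']
    refine h0 _ _ fun hW => hY' ⟨_, hW, ?_⟩
    funext i
    rfl
  have h0'' : ∀ (Y : Matrix (Fin 2) (Fin 2) ℂ) (v : V) (Y' : ι → Matrix (Fin 2) (Fin 2) ℂ),
      Y ∉ (fun W : Option ι → Matrix (Fin 2) (Fin 2) ℂ => W none) '' K → Φ' ((Y, v), Y') = 0 := by
    intro Y v Y' hY
    rw [hΦ']
    exact h0 _ _ fun hW => hY ⟨_, hW, rfl⟩
  -- the `ι`-place object of `Φ′` (opaque, with its defining formula) and the HYPOTHESIS at the slot `M₂ × V`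
  obtain ⟨Fι, hFι⟩ : ∃ Fι : (ι → ℝ) × (Matrix (Fin 2) (Fin 2) ℂ × V) → E, ∀ x, Fι x = (∏ i, 2 * Real.sin (x.1 i)) •
      ∫ h : (∀ i : ι, unitaryGroupOfForm (starRingEnd ℂ) ((Matrix.diagonal ![(2 : L), -2]).map (wl (some i)).1.embedding)), Φ' (x.2, fun i => (((h i * ⟨circleDiagonal 2 ![z (some i) * Circle.exp (x.1 i), z (some i) * Circle.exp (-(x.1 i))], circleDiagonal_mem_archLocal_diagonal L 2 ![(2 : L), -2] (wl (some i)) _⟩ * (h i)⁻¹ : unitaryGroupOfForm (starRingEnd ℂ) ((Matrix.diagonal ![(2 : L), -2]).map (wl (some i)).1.embedding)) : GL (Fin 2) ℂ) : Matrix (Fin 2) (Fin 2) ℂ)) ∂(Measure.pi fun i => ν (some i)) :=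
    ⟨_, fun _ => rfl⟩
  have hbdι : ∀ N : ℕ, ∃ B : ℝ, ∀ ψ₁ : ι → ℝ, (∀ i, 0 < (if (fun i => ε (some i)) i then ψ₁ i else -ψ₁ i) ∧ (if (fun i => ε (some i)) i then ψ₁ i else -ψ₁ i) < 1) →
      ∀ v' ∈ ((fun W : Option ι → Matrix (Fin 2) (Fin 2) ℂ => W none) '' K) ×ˢ KV, ‖iteratedFDeriv ℝ N Fι (ψ₁, v')‖ ≤ B := fun N =>
    hInv (Matrix (Fin 2) (Fin 2) ℂ × V) E Φ' hΦ'd _ (hK₀.prod hKV) _ hK' h0' Fι hFι N fun i => ε (some i)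
  -- (4a) the `ι`-place object is `C^∞` off the walls (★ p851118 at the slot `M₂ × V`), (4b) and vanishes when `Y ∉ K₀`
  have hRι : IsOpen {ψ₁ : ι → ℝ | ∀ i, Real.sin (ψ₁ i) ≠ 0} := by
    rw [Set.setOf_forall]
    exact isOpen_iInter_of_finite fun i => isOpen_ne_fun (Real.continuous_sin.comp (continuous_apply i)) continuous_const
  have hFιc : ContDiffOn ℝ ∞ Fι ({ψ₁ : ι → ℝ | ∀ i, Real.sin (ψ₁ i) ≠ 0} ×ˢ (Set.univ : Set (Matrix (Fin 2) (Fin 2) ℂ × V))) := by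
    have hP := contDiffOn_multiOrbitalIntegral_param L ![(2 : L), -2] (fun i => wl (some i)) (fun i => z (some i)) ha (fun i => ν (some i))
      (X := Matrix (Fin 2) (Fin 2) ℂ × V) (fun x W => Φ' (x, W)) (hΦ'd.comp (contDiff_fst.prodMk contDiff_snd)) ⟨_, hK', fun x W hW => h0' x W hW⟩
    refine (hP.comp (contDiff_snd.prodMk contDiff_fst).contDiffOn fun x hx => ⟨Set.mem_univ _, hx.1⟩).congr fun x _ => ?_
    exact hFι x
  have hFι0 : ∀ (ψ₁ : ι → ℝ) (Y : Matrix (Fin 2) (Fin 2) ℂ) (v : V), Y ∉ (fun W : Option ι → Matrix (Fin 2) (Fin 2) ℂ => W none) '' K → Fι (ψ₁, (Y, v)) = 0 := by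
    intro ψ₁ Y v hY
    rw [hFι]
    have hz : (fun h : (∀ i : ι, unitaryGroupOfForm (starRingEnd ℂ) ((Matrix.diagonal ![(2 : L), -2]).map (wl (some i)).1.embedding)) => Φ' ((ψ₁, (Y, v)).2, fun i => (((h i * ⟨circleDiagonal 2 ![z (some i) * Circle.exp ((ψ₁, (Y, v)).1 i), z (some i) * Circle.exp (-((ψ₁, (Y, v)).1 i))], circleDiagonal_mem_archLocal_diagonal L 2 ![(2 : L), -2] (wl (some i)) _⟩ * (h i)⁻¹ : unitaryGroupOfForm (starRingEnd ℂ) ((Matrix.diagonal ![(2 : L), -2]).map (wl (some i)).1.embedding)) : GL (Fin 2) ℂ) : Matrix (Fin 2) (Fin 2) ℂ))) = fun _ => 0 :=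
      funext fun h => h0'' Y v _ hY
    rw [hz, integral_zero, smul_zero]
  -- (5) re-bracket: `Ψ (Y, (ψ′, v)) = Fι (ψ′, (Y, v))` along a sup-norm isometry (same jets)
  obtain ⟨τ, -, hτs⟩ := exists_rebracket_isometry (ι := ι) (V := V) (M := Matrix (Fin 2) (Fin 2) ℂ)
  obtain ⟨Ψ, hΨdef⟩ : ∃ Ψ : Matrix (Fin 2) (Fin 2) ℂ × ((ι → ℝ) × V) → E, Ψ = Fι ∘ ⇑τ.symm := ⟨_, rfl⟩
  have hΨapp : ∀ (Y : Matrix (Fin 2) (Fin 2) ℂ) (ζ : (ι → ℝ) × V), Ψ (Y, ζ) = Fι (ζ.1, (Y, ζ.2)) := fun Y ζ => by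
    rw [hΨdef, Function.comp_apply, hτs]
  have hU : IsOpen ({ψ₁ : ι → ℝ | ∀ i, Real.sin (ψ₁ i) ≠ 0} ×ˢ (Set.univ : Set V)) := hRι.prod isOpen_univ
  have hΨc : ContDiffOn ℝ ∞ Ψ ((Set.univ : Set (Matrix (Fin 2) (Fin 2) ℂ)) ×ˢ ({ψ₁ : ι → ℝ | ∀ i, Real.sin (ψ₁ i) ≠ 0} ×ˢ (Set.univ : Set V))) := by
    rw [hΨdef]
    refine hFιc.comp τ.symm.contDiff.contDiffOn fun p hp => ?_
    rw [hτs]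
    exact ⟨hp.2.1, Set.mem_univ _⟩
  have h0Ψ : ∀ (Y : Matrix (Fin 2) (Fin 2) ℂ) (ζ : (ι → ℝ) × V), Y ∉ (fun W : Option ι → Matrix (Fin 2) (Fin 2) ℂ => W none) '' K → Ψ (Y, ζ) = 0 :=
    fun Y ζ hY => by rw [hΨapp]; exact hFι0 ζ.1 Y ζ.2 hY
  have hAU : ({ψ₁ : ι → ℝ | ∀ i, 0 < (if ε (some i) then ψ₁ i else -ψ₁ i) ∧ (if ε (some i) then ψ₁ i else -ψ₁ i) < 1} ×ˢ KV) ⊆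
      {ψ₁ : ι → ℝ | ∀ i, Real.sin (ψ₁ i) ≠ 0} ×ˢ (Set.univ : Set V) :=
    fun ζ hζ => ⟨fun i => sin_ne_zero_of_signedUnit (hζ.1 i), Set.mem_univ _⟩
  have hbdΨ : ∀ N : ℕ, ∃ B : ℝ, ∀ Y ∈ (fun W : Option ι → Matrix (Fin 2) (Fin 2) ℂ => W none) '' K,
      ∀ ζ ∈ ({ψ₁ : ι → ℝ | ∀ i, 0 < (if ε (some i) then ψ₁ i else -ψ₁ i) ∧ (if ε (some i) then ψ₁ i else -ψ₁ i) < 1} ×ˢ KV),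
        ‖iteratedFDeriv ℝ N Ψ (Y, ζ)‖ ≤ B := by
    intro N
    obtain ⟨B, hB⟩ := hbdι N
    refine ⟨B, fun Y hY ζ hζ => ?_⟩
    rw [hΨdef, LinearIsometryEquiv.norm_iteratedFDeriv_comp_right τ.symm Fι (Y, ζ) N, hτs]
    exact hB ζ.1 hζ.1 (Y, ζ.2) (Set.mk_mem_prod hY hζ.2)
  -- (6) the slice-jet family along the basis words of `Z = (ι → ℝ) × V`
  set b := Module.finBasis ℝ ((ι → ℝ) × V) with hb
  have hfam := fun l : ℕ => sliceJet_family Ψ hU hΨc hK₀c h0Ψ hAU hbdΨ (⇑b) l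
  -- (7) the outer one-place functional at the place `none` and THE `ℓ^∞` DEVICE over the family, order by order
  obtain ⟨F₀, hF₀⟩ : ∃ F₀ : (Matrix (Fin 2) (Fin 2) ℂ → E) → ℝ → E, ∀ (f : Matrix (Fin 2) (Fin 2) ℂ → E) (t : ℝ), F₀ f t = (2 * Real.sin t) •
      ∫ h : unitaryGroupOfForm (starRingEnd ℂ) ((Matrix.diagonal ![(2 : L), -2]).map (wl none).1.embedding), f (((h * ⟨circleDiagonal 2 ![z none * Circle.exp (t), z none * Circle.exp (-(t))], circleDiagonal_mem_archLocal_diagonal L 2 ![(2 : L), -2] (wl none) _⟩ * (h)⁻¹ : unitaryGroupOfForm (starRingEnd ℂ) ((Matrix.diagonal ![(2 : L), -2]).map (wl none).1.embedding)) : GL (Fin 2) ℂ) : Matrix (Fin 2) (Fin 2) ℂ) ∂(ν none) := ⟨_, fun _ _ => rfl⟩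
  have hdev : ∀ k l : ℕ, ∃ B : ℝ, ∀ t : ℝ, 0 < |t| → |t| < 1 →
      ∀ j : {j : ((ι → ℝ) × V) × (Fin l → Fin (Module.finrank ℝ ((ι → ℝ) × V))) //
        j.1 ∈ {ψ₁ : ι → ℝ | ∀ i, 0 < (if ε (some i) then ψ₁ i else -ψ₁ i) ∧ (if ε (some i) then ψ₁ i else -ψ₁ i) < 1} ×ˢ KV},
        ‖iteratedDeriv k (F₀ fun X => iteratedFDeriv ℝ l (fun q : (ι → ℝ) × V => Ψ (X, q)) j.1.1 fun i => b (j.1.2 i)) t‖ ≤ B := by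
    intro k l
    obtain ⟨hgc, hgb, hgz⟩ := hfam l
    -- the family, as a function on the index subtype
    obtain ⟨g, hg⟩ : ∃ g : {j : ((ι → ℝ) × V) × (Fin l → Fin (Module.finrank ℝ ((ι → ℝ) × V))) //
        j.1 ∈ {ψ₁ : ι → ℝ | ∀ i, 0 < (if ε (some i) then ψ₁ i else -ψ₁ i) ∧ (if ε (some i) then ψ₁ i else -ψ₁ i) < 1} ×ˢ KV} →
          Matrix (Fin 2) (Fin 2) ℂ → E, ∀ j, g j = fun X => iteratedFDeriv ℝ l (fun q : (ι → ℝ) × V => Ψ (X, q)) j.1.1 fun i => b (j.1.2 i) :=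
      ⟨_, fun _ => rfl⟩
    have hg1 : ∀ j, ContDiff ℝ ∞ (g j) := fun j => by
      rw [hg]
      exact hgc j.1.1 j.1.2 (hAU j.2)
    have hg2 : ∀ m : ℕ, ∃ B : ℝ, ∀ j (Y : Matrix (Fin 2) (Fin 2) ℂ), ‖iteratedFDeriv ℝ m (g j) Y‖ ≤ B := fun m => by
      obtain ⟨B, hB⟩ := hgb m
      refine ⟨B, fun j Y => ?_⟩
      rw [hg]
      exact hB j.1.1 j.1.2 j.2 Y
    have hg3 : ∀ j (Y : Matrix (Fin 2) (Fin 2) ℂ), Y ∉ (fun W : Option ι → Matrix (Fin 2) (Fin 2) ℂ => W none) '' K → g j Y = 0 := fun j Y hY => by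
      rw [hg]
      exact hgz j.1.1 j.1.2 Y hY
    obtain ⟨B, hB⟩ := exists_forall_norm_iteratedDeriv_orbitalIntegral_le_of_uniform_family L ![(2 : L), -2] (wl none) ha hreal hsgn hpq hqe (ν none) (z none) F₀ hF₀
      g hg1 hg2 hK₀ hg3 k
    refine ⟨B, fun t ht0 ht1 j => ?_⟩
    have h := hB t ht0 ht1 j
    rw [hg] at h
    exact h
  -- (8) split the variables of the `(Option ι)`-object: `f (t, (ψ′, v)) = FO (o ↦ o.elim t ψ′, v)` along a sup-norm isometry; `f` is `C^∞` off the walls (★ p851118)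
  obtain ⟨Λ, hΛ, hΛs⟩ := exists_splitOption_isometry (ι := ι) (V := V)
  obtain ⟨f, hfdef⟩ : ∃ f : ℝ × ((ι → ℝ) × V) → E, f = FO ∘ ⇑Λ.symm := ⟨_, rfl⟩
  have hfapp : ∀ (t : ℝ) (ζ : (ι → ℝ) × V), f (t, ζ) = FO (fun o => Option.elim o t ζ.1, ζ.2) := fun t ζ => by
    rw [hfdef, Function.comp_apply, hΛs]
  have hFOc : ContDiffOn ℝ ∞ FO ({ψ : Option ι → ℝ | ∀ o, Real.sin (ψ o) ≠ 0} ×ˢ (Set.univ : Set V)) := by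
    have hP := contDiffOn_multiOrbitalIntegral_param L ![(2 : L), -2] wl z ha ν (X := V) (fun v W => Φ (v, W)) (hΦ.comp (contDiff_fst.prodMk contDiff_snd))
      ⟨K, hK, fun v W hW => h0 v W hW⟩
    refine (hP.comp (contDiff_snd.prodMk contDiff_fst).contDiffOn fun x hx => ⟨Set.mem_univ _, hx.1⟩).congr fun x _ => ?_
    exact hFO x
  have hU' : IsOpen ({y : ℝ × ((ι → ℝ) × V) | Real.sin y.1 ≠ 0} ∩ Prod.snd ⁻¹' ({ψ₁ : ι → ℝ | ∀ i, Real.sin (ψ₁ i) ≠ 0} ×ˢ (Set.univ : Set V))) :=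
    (isOpen_ne_fun (Real.continuous_sin.comp continuous_fst) continuous_const).inter (hU.preimage continuous_snd)
  have hfc : ContDiffOn ℝ ∞ f ({y : ℝ × ((ι → ℝ) × V) | Real.sin y.1 ≠ 0} ∩ Prod.snd ⁻¹' ({ψ₁ : ι → ℝ | ∀ i, Real.sin (ψ₁ i) ≠ 0} ×ˢ (Set.univ : Set V))) := by
    rw [hfdef]
    refine hFOc.comp Λ.symm.contDiff.contDiffOn fun y hy => ?_
    rw [hΛs]
    refine ⟨fun o => ?_, Set.mem_univ _⟩
    cases o with
    | none => exact hy.1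
    | some i => exact hy.2.1 i
  have hAOU : {y : ℝ × ((ι → ℝ) × V) | (0 < (if ε none then y.1 else -y.1) ∧ (if ε none then y.1 else -y.1) < 1) ∧
      y.2 ∈ {ψ₁ : ι → ℝ | ∀ i, 0 < (if ε (some i) then ψ₁ i else -ψ₁ i) ∧ (if ε (some i) then ψ₁ i else -ψ₁ i) < 1} ×ˢ KV} ⊆
      {y : ℝ × ((ι → ℝ) × V) | Real.sin y.1 ≠ 0} ∩ Prod.snd ⁻¹' ({ψ₁ : ι → ℝ | ∀ i, Real.sin (ψ₁ i) ≠ 0} ×ˢ (Set.univ : Set V)) :=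
    fun y hy => ⟨sin_ne_zero_of_signedUnit hy.1, hAU hy.2⟩
  -- (9) IDENTIFICATION: the outer functional of a family member is a mixed partial of `f` (★ slot lemma at the regular angle `t`, Option-Fubini pointwise)
  have hident : ∀ (l : ℕ) (t : ℝ), Real.sin t ≠ 0 →
      ∀ ζ ∈ {ψ₁ : ι → ℝ | ∀ i, 0 < (if ε (some i) then ψ₁ i else -ψ₁ i) ∧ (if ε (some i) then ψ₁ i else -ψ₁ i) < 1} ×ˢ KV,
        ∀ I : Fin l → Fin (Module.finrank ℝ ((ι → ℝ) × V)),
          F₀ (fun X => iteratedFDeriv ℝ l (fun q : (ι → ℝ) × V => Ψ (X, q)) ζ fun i => b (I i)) t =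
            iteratedFDeriv ℝ l (fun q : (ι → ℝ) × V => f (t, q)) ζ fun i => b (I i) := by
    intro l t ht ζ hζ I
    have hζU := hAU hζ
    set Y₀ : unitaryGroupOfForm (starRingEnd ℂ) ((Matrix.diagonal ![(2 : L), -2]).map (wl none).1.embedding) → Matrix (Fin 2) (Fin 2) ℂ := fun h => (((h * ⟨circleDiagonal 2 ![z none * Circle.exp (t), z none * Circle.exp (-(t))], circleDiagonal_mem_archLocal_diagonal L 2 ![(2 : L), -2] (wl none) _⟩ * (h)⁻¹ : unitaryGroupOfForm (starRingEnd ℂ) ((Matrix.diagonal ![(2 : L), -2]).map (wl none).1.embedding)) : GL (Fin 2) ℂ) : Matrix (Fin 2) (Fin 2) ℂ) with hY₀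
    have hY₀c : Continuous Y₀ :=
      (Units.continuous_val.comp continuous_subtype_val).comp ((continuous_id.mul continuous_const).mul continuous_id.inv)
    have hY₀p : ∀ K₁ : Set (Matrix (Fin 2) (Fin 2) ℂ), IsCompact K₁ → IsCompact (Y₀ ⁻¹' K₁) := fun K₁ hK₁ =>
      isCompact_preimage_conj_torusPoint L ![(2 : L), -2] (wl none) ha (z none) ht hK₁
    obtain ⟨hcd, hkey⟩ := iteratedFDeriv_integral_slot_of_proper (M := Matrix (Fin 2) (Fin 2) ℂ) (Z := (ι → ℝ) × V) (E := E) (ν none) Y₀ hY₀c hY₀p Ψ hU hΨc hK₀ h0Ψ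
    obtain ⟨heq, hint⟩ := hkey l ζ hζU
    have hcda : ContDiffAt ℝ (l : ℕ) (fun q : (ι → ℝ) × V => ∫ h : unitaryGroupOfForm (starRingEnd ℂ) ((Matrix.diagonal ![(2 : L), -2]).map (wl none).1.embedding), Ψ (Y₀ h, q) ∂(ν none)) ζ :=
      (hcd.contDiffAt (hU.mem_nhds hζU)).of_le (by exact_mod_cast le_top)
    rw [hF₀]
    show (2 * Real.sin t) • ∫ h : unitaryGroupOfForm (starRingEnd ℂ) ((Matrix.diagonal ![(2 : L), -2]).map (wl none).1.embedding), iteratedFDeriv ℝ l (fun q : (ι → ℝ) × V => Ψ (Y₀ h, q)) ζ (fun i => b (I i)) ∂(ν none) = _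
    rw [← ContinuousMultilinearMap.integral_apply hint, ← heq, ← _root_.smul_apply, ← iteratedFDeriv_const_smul_apply' hcda]
    -- the two functions of `q` agree on the open `U ∋ ζ` (Option-Fubini at the regular angle vector `(t, q.1)`)
    have hev : (fun q : (ι → ℝ) × V => (2 * Real.sin t) • ∫ h : unitaryGroupOfForm (starRingEnd ℂ) ((Matrix.diagonal ![(2 : L), -2]).map (wl none).1.embedding), Ψ (Y₀ h, q) ∂(ν none)) =ᶠ[𝓝 ζ]
        fun q : (ι → ℝ) × V => f (t, q) := by
      filter_upwards [hU.mem_nhds hζU] with q hq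
      have hregq : ∀ o : Option ι, Real.sin ((fun o => Option.elim o t q.1) o) ≠ 0 := fun o => by
        cases o with
        | none => exact ht
        | some i => exact hq.1 i
      have h2 := multiOrbitalIntegral_option_eq_integral_integral L ![(2 : L), -2] wl z ha ν (fun W => Φ (q.2, W))
        (hΦ.continuous.comp (continuous_const.prodMk continuous_id)) hK (fun W hW => h0 q.2 W hW) (fun o => Option.elim o t q.1) hregq
      simp only [Option.elim_none, Option.elim_some] at h2
      simp only [hY₀, hΨapp, hFι, hΦ', hfapp, hFO, integral_smul, smul_smul, Fintype.prod_option, Option.elim_none, Option.elim_some]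
      rw [h2]
    rw [(hev.iteratedFDeriv ℝ l).eq_of_nhds]
  -- (10) mixed partials ⇒ joint jet of `f` on the split cube (★ «dict» (D4)), fed by the `ℓ^∞` device through the identification
  obtain ⟨Bf, hBf⟩ := exists_forall_norm_iteratedFDeriv_le_of_iteratedDeriv_partial b hU' hAOU hfc (N := n) fun k l _ I _ => by
    obtain ⟨B, hB⟩ := hdev k l
    refine ⟨B, fun y hy => ?_⟩
    have hty := abs_pos_lt_one_of_signedUnit hy.1
    have hsin : Real.sin y.1 ≠ 0 := sin_ne_zero_of_signedUnit hy.1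
    have hEq : (fun s : ℝ => iteratedFDeriv ℝ l (fun ζ : (ι → ℝ) × V => f (s, ζ)) y.2 fun j => b (I j)) =ᶠ[𝓝 y.1]
        fun s : ℝ => F₀ (fun X => iteratedFDeriv ℝ l (fun q : (ι → ℝ) × V => Ψ (X, q)) y.2 fun i => b (I i)) s := by
      filter_upwards [(isOpen_ne_fun Real.continuous_sin continuous_const).mem_nhds hsin] with s hs
      exact (hident l s hs y.2 hy.2 I).symm
    rw [Filter.EventuallyEq.iteratedDeriv_eq k hEq]
    exact hB y.1 hty.1 hty.2 ⟨(y.2, I), hy.2⟩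
  -- (11) back to the `(Option ι)`-variables along the splitting isometry
  refine ⟨Bf, fun ψ hψ v hv => ?_⟩
  have hFOf : FO = f ∘ ⇑Λ := by
    rw [hfdef]
    funext x
    simp only [Function.comp_apply, LinearIsometryEquiv.symm_apply_apply]
  rw [hFOf, LinearIsometryEquiv.norm_iteratedFDeriv_comp_right Λ f (ψ, v) n, hΛ]
  exact hBf _ ⟨hψ none, ⟨fun i => hψ (some i), hv⟩⟩

end Step

end Literature.NumberTheory.Automorphic.RankOneCasimir

end
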